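import Literature.Analysis.FluidPDE.BiotSavartHolderCurl
import HarnessLib

/-!
# Discharge of `divergence_biotSavart` and `curl_biotSavart`: the Biot–Savart velocity of a
# `C¹ ∩ L¹ ∩ L^∞` vorticity is `C¹`, divergence free, and has curl `ω` when `div ω = 0`

Analysis/FluidPDE file **discharging** the named facts
`Literature.Analysis.FluidPDE.divergence_biotSavart` and `Literature.Analysis.FluidPDE.curl_biotSavart`
(`Vorticity.lean`; A. J. Majda, A. L. Bertozzi, *Vorticity and Incompressible Flow* (CUP 2002),
§2.4.1 **Prop. 2.16** and its proof, eq. (2.96) `div curl ψ = 0`, p. 63–64 of the held text, and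
§2.4.3 **Prop. 2.19**, p. 67: "the velocity fields (2.94) are divergence free, div v = 0"): for a
`C¹` vorticity `ω` on `ℝ³` with `ω ∈ L¹ ∩ L^∞` the Biot–Savart velocity
`v = K₃ ∗ ω = biotSavart ω` satisfies `div v = 0` pointwise, and `curl v = ω` if `div ω = 0`.

## Proof

The tree already has Prop. 2.16/2.19 in *weak* form for a merely continuous `ω ∈ L¹ ∩ L^∞`
(`isWeaklyDivFree_biotSavart`: `∫ ⟪K₃ ∗ ω, ∇θ⟫ = ∫ ⟪ω, K₃ ∗ ∇θ⟫ = 0` because `K₃ ∗ ∇θ = 0`, which is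
(2.92)/(2.96) read weakly; and `integral_inner_biotSavart_curlPair_eq_of_isWeaklyDivFree`, the weak
form of `curl (K₃ ∗ ω) = ω`), together with the pointwise conclusions
`isDivFree_biotSavart_of_contDiff`, `curl_biotSavart_eq_of_isWeaklyDivFree` (`BiotSavartHolderCurl.lean`)
*as soon as `K₃ ∗ ω ∈ C¹`*. What is proved here is that regularity statement at the level of the
facts as vendored (no compact support):

* `hasFDerivAt_truncPotential_of_integrable`, `continuous_integral_fderiv_truncKernel_flip`,
  `contDiff_truncPotential_of_integrable` — the regularised potential `∫ K_ε(x − y) f(y) dy` of the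
  tree's smoothly truncated kernel `K_ε = truncKernel K ε` (`SingularKernelTruncation.lean`,
  Gilbarg–Trudinger §4.1) is `C¹` for every **continuous integrable** density `f` (the tree's
  `hasFDerivAt_truncPotential` asks compact support): `∇K_ε` is bounded by `A(1+2B)ε⁻³`, so
  `x ↦ (∇K_ε(x − y) ·)(f y)` is dominated by an `L¹` function uniformly in `x` (Mathlib
  `hasFDerivAt_integral_of_dominated_of_fderiv_le`, `continuous_of_dominated`);
* `contDiff_biotSavart_of_contDiff` — **`K₃ ∗ ω ∈ C¹` for `ω ∈ C¹ ∩ L¹ ∩ L^∞`**: near a point `x₀`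
  split the *density* with the tree's cutoff `χ = suppCutoff x₀ 1` (`= 1` on `B̄(x₀, 1)`, `= 0` off
  `B(x₀, 2)`): `ω = χω + (1 − χ)ω`, `K₃ ∗ ω = K₃ ∗ (χω) + K₃ ∗ ((1 − χ)ω)`
  (`biotSavart_eq_add_of_suppCutoff`; both integrals converge at every point,
  `integrable_biotSavartKernel_sub_apply`). The near density `χω` is `C¹` with compact support, hence
  Lipschitz, hence `1`-Hölder, and `K₃ ∗ (χω) ∈ C¹` by the tree's Hölder theory
  `contDiff_biotSavart` (Majda–Bertozzi Prop. 2.20 / (4.39), Gilbarg–Trudinger Lemma 4.2); the far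
  density `(1 − χ)ω` vanishes on `B(x₀, 1)`, so on `B(x₀, 1/2)` its Biot–Savart integral *is* the
  regularised potential with `ε = 1/4` (`biotSavart_far_eq_truncPotential`), which is `C¹` by the
  first item;
* `divergence_biotSavart_holds`, `curl_biotSavart_holds` — the discharges (for the curl, a `C¹`
  divergence-free `ω` is weakly divergence free, `VectorCalculus.IsDivFree.isWeaklyDivFree_holds`).

Deviation from the printed proof: Majda–Bertozzi argue `v = −curl ψ`, `div curl ψ = 0` for the
smooth Newtonian potential `ψ` of a smooth rapidly decaying `ω` (p. 64), and prove Prop. 2.19 through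
the principal-value derivative formula of Prop. 2.17 ("the proof of the 3D case we leave to the
reader", p. 67). At the `C¹ ∩ L¹ ∩ L^∞` regularity of the vendored facts the tree's weak identities
plus the `C¹` regularity above are the shorter road; the hypotheses on `∇ω` in the facts
(`∇ω ∈ L¹ ∩ L^∞`) are not needed and are left unused.

## Mathlib / tree search

Tree (all used): `isDivFree_biotSavart_of_contDiff`, `curl_biotSavart_eq_of_isWeaklyDivFree`
(`BiotSavartHolderCurl`), `contDiff_biotSavart`, `exists_isC1SingularKernel_biotSavartCLM`,
`biotSavartCLM` (`BiotSavartGradient`), `truncKernel`, `truncPotential`, `contDiff_truncKernel`,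
`norm_truncKernel_le_const`, `norm_fderiv_truncKernel_le_const`, `truncKernel_eq`,
`continuous_truncKernel_sub_apply`, `exists_norm_fderiv_radialCutoff_le` (`SingularKernelTruncation`),
`suppCutoff` and its API (`SingularKernelGradient`), `integrable_biotSavartKernel_sub_apply`
(`BiotSavartIntegral`), `VectorCalculus.IsDivFree.isWeaklyDivFree_holds` (`VectorCalculus`).
Mathlib: `hasFDerivAt_integral_of_dominated_of_fderiv_le`, `continuous_of_dominated`,
`contDiff_one_iff_fderiv`, `ContDiff.lipschitzWith_of_hasCompactSupport`, `LipschitzWith.holderWith`,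
`contDiff_iff_contDiffAt`, `ContDiffAt.congr_of_eventuallyEq`. `lean search 'divergence_biotSavart'`,
`'curl_biotSavart'`: only the torus versions `BDSV.divergence_biotSavart`, `BDSV.curl_biotSavart`
(smooth fields on `𝕋³`) and the Hölder/compact-support versions of `BiotSavartHolderCurl.lean`.

## References

* A. J. Majda, A. L. Bertozzi, *Vorticity and Incompressible Flow*, Cambridge Texts in Applied
  Mathematics 27 (CUP 2002), doi:10.1017/cbo9780511613203: §2.4.1 Prop. 2.16 and its proof,
  (2.94)–(2.96) (p. 63–64 of the held text); §2.4.3 Prop. 2.19 (p. 67), Prop. 2.20.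
  [MajdaBertozziCUP2002]
* D. Gilbarg, N. S. Trudinger, *Elliptic Partial Differential Equations of Second Order*
  (Springer 2001), §4.1 Lemmas 4.1–4.2 (regularised potentials). [GilbargTrudinger2001]
-/

noncomputable section

open MeasureTheory Set Function Filter Metric Real
open _root_.Topology
open scoped ENNReal NNReal

namespace Literature.Analysis.FluidPDE

/-! ### The regularised potential of an integrable density is `C¹` -/

section TruncPotential

variable {V W : Type*} [NormedAddCommGroup V] [NormedSpace ℝ V] [NormedAddCommGroup W]
  [NormedSpace ℝ W]

/-- **The regularised potential of a continuous integrable density is differentiable, with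
derivative under the integral sign**: `∇(∫ K_ε(x − y) f(y) dy)(x₀) = ∫ (∇K_ε(x₀ − y) ·)(f y) dy` for
`f ∈ C ∩ L¹` (the tree's `hasFDerivAt_truncPotential` for compactly supported `f`, with the
domination `‖(∇K_ε(x − y) ·)(f y)‖ ≤ A(1+2B)ε⁻³ ‖f y‖ ∈ L¹` now coming from `f ∈ L¹`;
Gilbarg–Trudinger §4.1, proof of Lemma 4.1). [cite: GilbargTrudinger2001, §4.1 Lemma 4.1 (proof, the regularised potential `w_ε`)] -/
theorem hasFDerivAt_truncPotential_of_integrable {K : (EuclideanSpace ℝ (Fin 3)) → V →L[ℝ] W}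
    {A : ℝ} (hK : IsC1SingularKernel K A) {ε : ℝ} (hε : 0 < ε) {f : (EuclideanSpace ℝ (Fin 3)) → V}
    (hf : Continuous f) (hfi : Integrable f) (x₀ : (EuclideanSpace ℝ (Fin 3))) :
    HasFDerivAt (truncPotential K ε f)
      (∫ y, (fderiv ℝ (truncKernel K ε) (x₀ - y)).flip (f y)) x₀ := by
  obtain ⟨B, hB0, hB⟩ := exists_norm_fderiv_radialCutoff_le
  set C : ℝ := A * (1 + 2 * B) * (ε ^ 3)⁻¹ with hC
  have hcont : ContDiff ℝ 1 (truncKernel K ε) := contDiff_truncKernel hK hε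
  have hDc : Continuous (fderiv ℝ (truncKernel K ε)) := hcont.continuous_fderiv one_ne_zero
  -- the derivative integrand and its continuity in `y`
  have hF'c : ∀ x : (EuclideanSpace ℝ (Fin 3)),
      Continuous fun y => (fderiv ℝ (truncKernel K ε) (x - y)).flip (f y) := by
    intro x
    have h1 : Continuous fun y => (fderiv ℝ (truncKernel K ε) (x - y)).flip :=
      (ContinuousLinearMap.flipₗᵢ ℝ (EuclideanSpace ℝ (Fin 3)) V W).continuous.comp
        (hDc.comp (continuous_const.sub continuous_id))
    exact h1.clm_apply hf
  unfold truncPotential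
  refine hasFDerivAt_integral_of_dominated_of_fderiv_le (𝕜 := ℝ) (μ := volume) (s := univ)
    (F := fun x y => truncKernel K ε (x - y) (f y))
    (F' := fun x y => (fderiv ℝ (truncKernel K ε) (x - y)).flip (f y))
    (bound := fun y => C * ‖f y‖) univ_mem ?_ ?_ ?_ ?_ ?_ ?_
  · exact Eventually.of_forall fun x =>
      (continuous_truncKernel_sub_apply hK hε hf x).aestronglyMeasurable
  · refine (hfi.norm.const_mul (A * (ε ^ 2)⁻¹)).mono'
      (continuous_truncKernel_sub_apply hK hε hf x₀).aestronglyMeasurable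
      (Eventually.of_forall fun y => ?_)
    calc ‖truncKernel K ε (x₀ - y) (f y)‖ ≤ ‖truncKernel K ε (x₀ - y)‖ * ‖f y‖ :=
          ContinuousLinearMap.le_opNorm _ _
      _ ≤ A * (ε ^ 2)⁻¹ * ‖f y‖ := by
          gcongr
          exact norm_truncKernel_le_const hK hε (x₀ - y)
  · exact (hF'c x₀).aestronglyMeasurable
  · refine Eventually.of_forall fun y x _ => ?_
    calc ‖(fderiv ℝ (truncKernel K ε) (x - y)).flip (f y)‖
        ≤ ‖(fderiv ℝ (truncKernel K ε) (x - y)).flip‖ * ‖f y‖ := ContinuousLinearMap.le_opNorm _ _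
      _ = ‖fderiv ℝ (truncKernel K ε) (x - y)‖ * ‖f y‖ := by rw [ContinuousLinearMap.opNorm_flip]
      _ ≤ C * ‖f y‖ := by
          gcongr
          exact norm_fderiv_truncKernel_le_const hK hB0 hB hε (x - y)
  · exact hfi.norm.const_mul C
  · refine Eventually.of_forall fun y x _ => ?_
    have h1 : HasFDerivAt (truncKernel K ε) (fderiv ℝ (truncKernel K ε) (x - y)) (x - y) :=
      ((hcont.differentiable one_ne_zero) _).hasFDerivAt
    have h2 : HasFDerivAt (fun x : (EuclideanSpace ℝ (Fin 3)) => x - y)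
        (ContinuousLinearMap.id ℝ (EuclideanSpace ℝ (Fin 3))) x :=
      (hasFDerivAt_id x).sub_const y
    have h3 := h1.comp x h2
    have h4 := h3.clm_apply (hasFDerivAt_const (f y) x)
    refine h4.congr_fderiv ?_
    ext e
    simp

/-- **The derivative of the regularised potential is continuous**:
`x ↦ ∫ (∇K_ε(x − y) ·)(f y) dy` is continuous for `f ∈ C ∩ L¹` (dominated convergence: the
integrand is continuous in `x` and dominated by `A(1+2B)ε⁻³ ‖f y‖ ∈ L¹`; Gilbarg–Trudinger §4.1,
proof of Lemma 4.1, "`w_ε ∈ C¹`"). [cite: GilbargTrudinger2001, §4.1 Lemma 4.1 (proof, `w_ε ∈ C¹`)] -/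
theorem continuous_integral_fderiv_truncKernel_flip {K : (EuclideanSpace ℝ (Fin 3)) → V →L[ℝ] W}
    {A : ℝ} (hK : IsC1SingularKernel K A) {ε : ℝ} (hε : 0 < ε) {f : (EuclideanSpace ℝ (Fin 3)) → V}
    (hf : Continuous f) (hfi : Integrable f) :
    Continuous fun x : (EuclideanSpace ℝ (Fin 3)) =>
      ∫ y, (fderiv ℝ (truncKernel K ε) (x - y)).flip (f y) := by
  obtain ⟨B, hB0, hB⟩ := exists_norm_fderiv_radialCutoff_le
  set C : ℝ := A * (1 + 2 * B) * (ε ^ 3)⁻¹ with hC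
  have hcont : ContDiff ℝ 1 (truncKernel K ε) := contDiff_truncKernel hK hε
  have hDc : Continuous (fderiv ℝ (truncKernel K ε)) := hcont.continuous_fderiv one_ne_zero
  refine continuous_of_dominated (bound := fun y => C * ‖f y‖) (fun x => ?_) (fun x => ?_)
    (hfi.norm.const_mul C) (Eventually.of_forall fun y => ?_)
  · have h1 : Continuous fun y => (fderiv ℝ (truncKernel K ε) (x - y)).flip :=
      (ContinuousLinearMap.flipₗᵢ ℝ (EuclideanSpace ℝ (Fin 3)) V W).continuous.comp
        (hDc.comp (continuous_const.sub continuous_id))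
    exact (h1.clm_apply hf).aestronglyMeasurable
  · refine Eventually.of_forall fun y => ?_
    calc ‖(fderiv ℝ (truncKernel K ε) (x - y)).flip (f y)‖
        ≤ ‖(fderiv ℝ (truncKernel K ε) (x - y)).flip‖ * ‖f y‖ := ContinuousLinearMap.le_opNorm _ _
      _ = ‖fderiv ℝ (truncKernel K ε) (x - y)‖ * ‖f y‖ := by rw [ContinuousLinearMap.opNorm_flip]
      _ ≤ C * ‖f y‖ := by
          gcongr
          exact norm_fderiv_truncKernel_le_const hK hB0 hB hε (x - y)
  · have h1 : Continuous fun x : (EuclideanSpace ℝ (Fin 3)) =>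
        (fderiv ℝ (truncKernel K ε) (x - y)).flip :=
      (ContinuousLinearMap.flipₗᵢ ℝ (EuclideanSpace ℝ (Fin 3)) V W).continuous.comp
        (hDc.comp (continuous_id.sub continuous_const))
    exact h1.clm_apply continuous_const

/-- **The regularised potential of a continuous integrable density is `C¹`** (Gilbarg–Trudinger
§4.1, proof of Lemma 4.1: "`w_ε ∈ C¹(ℝⁿ)`", here without compact support of the density). [cite: GilbargTrudinger2001, §4.1 Lemma 4.1 (proof, `w_ε ∈ C¹`)] -/
theorem contDiff_truncPotential_of_integrable {K : (EuclideanSpace ℝ (Fin 3)) → V →L[ℝ] W}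
    {A : ℝ} (hK : IsC1SingularKernel K A) {ε : ℝ} (hε : 0 < ε) {f : (EuclideanSpace ℝ (Fin 3)) → V}
    (hf : Continuous f) (hfi : Integrable f) : ContDiff ℝ 1 (truncPotential K ε f) := by
  rw [contDiff_one_iff_fderiv]
  refine ⟨fun x => (hasFDerivAt_truncPotential_of_integrable hK hε hf hfi x).differentiableAt, ?_⟩
  have hD : fderiv ℝ (truncPotential K ε f) =
      fun x => ∫ y, (fderiv ℝ (truncKernel K ε) (x - y)).flip (f y) :=
    funext fun x => (hasFDerivAt_truncPotential_of_integrable hK hε hf hfi x).fderiv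
  rw [hD]
  exact continuous_integral_fderiv_truncKernel_flip hK hε hf hfi

end TruncPotential

/-! ### `K₃ ∗ ω ∈ C¹` for `ω ∈ C¹ ∩ L¹ ∩ L^∞` -/

section Regularity

variable {ω : (EuclideanSpace ℝ (Fin 3)) → (EuclideanSpace ℝ (Fin 3))} {C : ℝ}

/-- **Splitting the density**: for `ω ∈ L¹ ∩ L^∞` measurable and the cutoff `χ = suppCutoff x₀ 1`,
`K₃ ∗ ω = K₃ ∗ (χω) + K₃ ∗ ((1 − χ)ω)` pointwise (both integrals converge absolutely at every point,
`integrable_biotSavartKernel_sub_apply`, and the kernel is linear in the vorticity slot). [folklore] -/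
theorem biotSavart_eq_add_of_suppCutoff (hωm : Measurable ω) (hωi : Integrable ω)
    (hωb : ∀ y, ‖ω y‖ ≤ C) (x₀ x : (EuclideanSpace ℝ (Fin 3))) :
    biotSavart ω x = biotSavart (fun y => suppCutoff x₀ 1 y • ω y) x +
      biotSavart (fun y => (1 - suppCutoff x₀ 1 y) • ω y) x := by
  have hχc : Continuous (suppCutoff x₀ 1) := (contDiff_suppCutoff x₀ 1 (n := 0)).continuous
  have hχm : Measurable (suppCutoff x₀ 1) := hχc.measurable
  have hχ1 : ∀ y, |suppCutoff x₀ 1 y| ≤ 1 := abs_suppCutoff_le_one x₀ 1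
  have hχ1' : ∀ y, |1 - suppCutoff x₀ 1 y| ≤ 1 := fun y => by
    have h0 : 0 ≤ suppCutoff x₀ 1 y := radialCutoff_nonneg _ _ _
    have h1 : suppCutoff x₀ 1 y ≤ 1 := radialCutoff_le_one _ _ _
    rw [abs_le]
    constructor <;> linarith
  -- the two densities are measurable, integrable and bounded by `C`
  have hm₁ : Measurable fun y => suppCutoff x₀ 1 y • ω y := hχm.smul hωm
  have hm₂ : Measurable fun y => (1 - suppCutoff x₀ 1 y) • ω y :=
    (measurable_const.sub hχm).smul hωm
  have hi₁ : Integrable fun y => suppCutoff x₀ 1 y • ω y := by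
    refine hωi.norm.mono' hm₁.aestronglyMeasurable (Eventually.of_forall fun y => ?_)
    rw [norm_smul, Real.norm_eq_abs]
    exact mul_le_of_le_one_left (norm_nonneg _) (hχ1 y)
  have hi₂ : Integrable fun y => (1 - suppCutoff x₀ 1 y) • ω y := by
    refine hωi.norm.mono' hm₂.aestronglyMeasurable (Eventually.of_forall fun y => ?_)
    rw [norm_smul, Real.norm_eq_abs]
    exact mul_le_of_le_one_left (norm_nonneg _) (hχ1' y)
  have hb₁ : ∀ y, ‖suppCutoff x₀ 1 y • ω y‖ ≤ C := fun y => by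
    rw [norm_smul, Real.norm_eq_abs]
    exact (mul_le_of_le_one_left (norm_nonneg _) (hχ1 y)).trans (hωb y)
  have hb₂ : ∀ y, ‖(1 - suppCutoff x₀ 1 y) • ω y‖ ≤ C := fun y => by
    rw [norm_smul, Real.norm_eq_abs]
    exact (mul_le_of_le_one_left (norm_nonneg _) (hχ1' y)).trans (hωb y)
  have I₁ := integrable_biotSavartKernel_sub_apply hm₁ hi₁ hb₁ x
  have I₂ := integrable_biotSavartKernel_sub_apply hm₂ hi₂ hb₂ x
  simp only [biotSavart]
  rw [← integral_add I₁ I₂]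
  refine integral_congr_ae (Eventually.of_forall fun y => ?_)
  simp only
  rw [← biotSavartCLM_apply, ← biotSavartCLM_apply, ← biotSavartCLM_apply, ← map_add, ← add_smul,
    add_sub_cancel, one_smul]

/-- **The far density sees only the truncated kernel**: if `χ = suppCutoff x₀ 1` and
`‖x − x₀‖ < 1/2`, then `(K₃ ∗ ((1 − χ)ω))(x) = ∫ K_{1/4}(x − y) ((1 − χ(y)) ω(y)) dy` with the
smoothly truncated kernel `K_{1/4} = truncKernel biotSavartCLM (1/4)` (`= K₃` for `‖x − y‖ ≥ 1/2`,
while for `‖x − y‖ < 1/2` the density vanishes since `‖y − x₀‖ < 1`). [folklore] -/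
theorem biotSavart_far_eq_truncPotential
    (ω : (EuclideanSpace ℝ (Fin 3)) → (EuclideanSpace ℝ (Fin 3)))
    {x₀ x : (EuclideanSpace ℝ (Fin 3))} (hx : ‖x - x₀‖ < 1 / 2) :
    biotSavart (fun y => (1 - suppCutoff x₀ 1 y) • ω y) x =
      truncPotential biotSavartCLM (1 / 4) (fun y => (1 - suppCutoff x₀ 1 y) • ω y) x := by
  simp only [biotSavart, truncPotential]
  refine integral_congr_ae (Eventually.of_forall fun y => ?_)
  simp only
  rcases le_or_gt (1 / 2 : ℝ) ‖x - y‖ with hfar | hnear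
  · rw [truncKernel_eq biotSavartCLM (by norm_num : (0 : ℝ) < 1 / 4) (by linarith),
      biotSavartCLM_apply]
  · have hy : ‖y - x₀‖ ≤ 1 := by
      have h1 : ‖y - x₀‖ ≤ ‖y - x‖ + ‖x - x₀‖ := norm_sub_le_norm_sub_add_norm_sub y x x₀
      rw [norm_sub_rev y x] at h1
      linarith
    rw [suppCutoff_eq_one one_pos hy, sub_self, zero_smul, map_zero, biotSavartKernel_zero_right]

/-- **The Biot–Savart velocity of a `C¹ ∩ L¹ ∩ L^∞` vorticity is `C¹`** (the regularity behind
Majda–Bertozzi Prop. 2.16/2.19 at the level of the vendored facts; Prop. 2.20 / (4.39) give much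
more for Hölder `ω`). Near `x₀`: `K₃ ∗ ω = K₃ ∗ (χω) + K₃ ∗ ((1 − χ)ω)` with `χ = suppCutoff x₀ 1`;
the first density is `C¹` with compact support, hence Lipschitz, hence `1`-Hölder, so its velocity
is `C¹` (`contDiff_biotSavart`); the second velocity agrees near `x₀` with a regularised potential of
an `L¹` density (`biotSavart_far_eq_truncPotential`), which is `C¹`
(`contDiff_truncPotential_of_integrable`). No hypothesis on `∇ω` is needed. [cite: MajdaBertozziCUP2002, §2.4.3 Prop. 2.19–2.20 (p. 67 of the held text)] -/
theorem contDiff_biotSavart_of_contDiff (hω : ContDiff ℝ 1 ω) (hωi : Integrable ω)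
    (hωb : ∀ y, ‖ω y‖ ≤ C) : ContDiff ℝ 1 (biotSavart ω) := by
  obtain ⟨A, hK⟩ := exists_isC1SingularKernel_biotSavartCLM
  have hωc : Continuous ω := hω.continuous
  rw [contDiff_iff_contDiffAt]
  intro x₀
  set ω₁ : (EuclideanSpace ℝ (Fin 3)) → (EuclideanSpace ℝ (Fin 3)) :=
    fun y => suppCutoff x₀ 1 y • ω y with hω₁
  set ω₂ : (EuclideanSpace ℝ (Fin 3)) → (EuclideanSpace ℝ (Fin 3)) :=
    fun y => (1 - suppCutoff x₀ 1 y) • ω y with hω₂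
  have hχ : ContDiff ℝ 1 (suppCutoff x₀ 1) := contDiff_suppCutoff x₀ 1 (n := 1)
  -- the near part: `C¹` with compact support, hence Hölder, hence `K₃ ∗ ω₁ ∈ C¹`
  have h₁ : ContDiff ℝ 1 (biotSavart ω₁) := by
    have hc₁ : ContDiff ℝ 1 ω₁ := hχ.smul hω
    have hs₁ : HasCompactSupport ω₁ := (hasCompactSupport_suppCutoff x₀ one_pos).smul_right
    obtain ⟨L, hL⟩ := hc₁.lipschitzWith_of_hasCompactSupport hs₁ one_ne_zero
    exact contDiff_biotSavart one_pos hL.holderWith hs₁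
  -- the far part: a regularised potential of an `L¹` density near `x₀`
  have h₂ : ContDiffAt ℝ 1 (biotSavart ω₂) x₀ := by
    have hc₂ : Continuous ω₂ :=
      (continuous_const.sub (contDiff_suppCutoff x₀ 1 (n := 0)).continuous).smul hωc
    have hi₂ : Integrable ω₂ := by
      refine hωi.norm.mono' hc₂.aestronglyMeasurable (Eventually.of_forall fun y => ?_)
      have h0 : 0 ≤ suppCutoff x₀ 1 y := radialCutoff_nonneg _ _ _
      have h1 : suppCutoff x₀ 1 y ≤ 1 := radialCutoff_le_one _ _ _
      rw [hω₂, norm_smul, Real.norm_eq_abs]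
      refine mul_le_of_le_one_left (norm_nonneg _) ?_
      rw [abs_le]
      constructor <;> linarith
    have hT : ContDiff ℝ 1 (truncPotential biotSavartCLM (1 / 4) ω₂) :=
      contDiff_truncPotential_of_integrable hK (by norm_num) hc₂ hi₂
    refine hT.contDiffAt.congr_of_eventuallyEq ?_
    have hU : ball x₀ (1 / 2) ∈ 𝓝 x₀ := ball_mem_nhds x₀ (by norm_num)
    filter_upwards [hU] with x hx
    rw [mem_ball, dist_eq_norm] at hx
    exact biotSavart_far_eq_truncPotential ω hx
  -- assemble
  have hsplit : biotSavart ω = fun x => biotSavart ω₁ x + biotSavart ω₂ x :=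
    funext fun x => biotSavart_eq_add_of_suppCutoff hωc.measurable hωi hωb x₀ x
  rw [hsplit]
  exact h₁.contDiffAt.add h₂

end Regularity

/-! ### The discharges -/

/-- **Discharge of `divergence_biotSavart`** (Majda–Bertozzi Prop. 2.16, proof, eq. (2.96):
"`v = −curl ψ` … by identity (2.96) this vector is divergence free"; Prop. 2.19: "the velocity fields
(2.94) are divergence free"): for `ω ∈ C¹` with `ω, ∇ω ∈ L¹ ∩ L^∞`, `div (K₃ ∗ ω) = 0` pointwise.
Proof: `K₃ ∗ ω ∈ C¹` (`contDiff_biotSavart_of_contDiff`) and the tree's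
`isDivFree_biotSavart_of_contDiff` (weak divergence-freeness `∫ ⟪K₃ ∗ ω, ∇θ⟫ = ∫ ⟪ω, K₃ ∗ ∇θ⟫ = 0`
plus du Bois-Reymond); the hypotheses on `∇ω` are not used. [cite: MajdaBertozziCUP2002, §2.4.1 Prop. 2.16 (proof, eq. (2.96), p. 64 of the held text); §2.4.3 Prop. 2.19 (p. 67)] -/
theorem divergence_biotSavart_holds : divergence_biotSavart := by
  intro ω hω hint _ hbdd
  obtain ⟨C, hC⟩ := hbdd
  exact isDivFree_biotSavart_of_contDiff hω.continuous hint (fun y => (hC y).1)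
    (contDiff_biotSavart_of_contDiff hω hint fun y => (hC y).1)

/-- **Discharge of `curl_biotSavart`** (Majda–Bertozzi Prop. 2.16 (ii): for `div ω = 0`,
`v = K₃ ∗ ω` solves `curl v = ω`): for a `C¹`, divergence-free `ω` with `ω, ∇ω ∈ L¹ ∩ L^∞`,
`curl (K₃ ∗ ω) = ω` pointwise. Proof: `K₃ ∗ ω ∈ C¹` (`contDiff_biotSavart_of_contDiff`), `ω` is
weakly divergence free (`VectorCalculus.IsDivFree.isWeaklyDivFree_holds`), and the tree's
`curl_biotSavart_eq_of_isWeaklyDivFree` (the weak identity `curl (K₃ ∗ ω) = ω` integrated by parts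
onto the `C¹` velocity, fundamental lemma of the calculus of variations); the hypotheses on `∇ω`
are not used. [cite: MajdaBertozziCUP2002, §2.4.1 Prop. 2.16 (ii) and its proof (p. 63–64 of the held text)] -/
theorem curl_biotSavart_holds : curl_biotSavart := by
  intro ω hω hdiv hint _ hbdd
  obtain ⟨C, hC⟩ := hbdd
  exact curl_biotSavart_eq_of_isWeaklyDivFree hω.continuous hint (fun y => (hC y).1)
    (VectorCalculus.IsDivFree.isWeaklyDivFree_holds hdiv hω)
    (contDiff_biotSavart_of_contDiff hω hint fun y => (hC y).1)

end Literature.Analysis.FluidPDE
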